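import Literature.AlgebraicGeometry.Motives.HodgeStructureLefschetzGroupInternalBlocks
import Literature.AlgebraicGeometry.Motives.HodgeStructureLefschetzGroupDirectSum
import HarnessLib

/-!
# «`C(A) ⊂ C(A₁) × ⋯ × C(A_s)`, WITH EQUALITY HOLDING IF AND ONLY IF `Hom(Aᵢ, Aⱼ) = 0` FOR ALL `i ≠ j`» INTERNALLY: for an internal
# direct sum `V = ⊕_k W_k` of sub-Hodge structures, restriction `C(H) ↪ Π_k C(W_k)` (and `S(H)(ℚ) ↪ Π_k S(W_k)(ℚ)`) is onto iff the
# blocks are Hom-orthogonal iff the blocks are `E_φ`-stable iff `dim C(H) = Σ_k dim C(W_k)` (Milne 1999 §1 p. 643)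

[topic AlgebraicGeometry/Motives]

Layer `Literature/AlgebraicGeometry/Motives`, lane `lit-hodgefound` (Track 2 foundations library; prover seat
`lit-hodgefound-p02`, generation 52, self-proposed row g52-#7). THEOREMS ONLY: no definition, no named fact (net debt `0`),
no instance, no notation.  Completes g52-#3 `Motives/HodgeStructureCentralizerInternalBlocks` (`C(H) ↪ Π_k C(W_k)` always,
`exists_algHom_pi_centralizer`; `≃ₐ` for Hom-orthogonal blocks, `exists_algEquiv_pi_centralizer_of_hom_orthogonal`; stable ⟹
Hom-orthogonal, `hom_eq_zero_of_forall_stable`) and g52-#4 `Motives/HodgeStructureLefschetzGroupInternalBlocks` (`S(H)(ℚ) ↪ Π_k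
S(W_k)(ℚ)`, `≃*` for Hom-orthogonal blocks, `Polarization.exists_mulEquiv_pi_lefschetzGroup_of_hom_orthogonal`,
`Polarization.exists_mem_lefschetzGroup_forall_apply_eq_of_hom_orthogonal`) by the CONVERSES — Milne's «if and only if» — using
the Hodge endomorphism `ι_l ∘ f ∘ π_k` of a morphism `f : W_k → W_l` (projections `SubHodgeStructure.internalProjHom`, Voisin Lemma
7.26) and, for `S`, the block-sign element `(-1_{W_k}, 1, …, 1)` (`-1 ∈ S(ℚ)`: p34's `Polarization.neg_mem_lefschetzGroup`,
`Motives/HodgeStructureLefschetzGroupDirectSum`); Hom-orthogonal ⟹ stable is the tree's `apply_mem_of_hom_orthogonal`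
(`Motives/HodgeStructureIsotypicEndomorphismAlgebra`).  p34's `Motives/HodgeStructureLefschetzGroupFiniteDirectSum` has the EXTERNAL
forms (`forall_piDiag_mem_centralizer_endAlg_pi_iff`, `Polarization.forall_piCongrRight_mem_lefschetzGroup_pi_iff` on `⊕_j H_j`); here
the blocks are sub-Hodge structures `W_k ⊆ V` of one Hodge structure.

## The source, verbatim

J. S. Milne, *Lefschetz classes on abelian varieties*, Duke Math. J. 96 (1999) 639–675 [Milne1999LefschetzClasses] (held
`paper:doi-10-1215-s0012-7094-99-09620-5`), §1 p. 643 L13–L15: "Let `A = A₁ × ⋯ × A_s`. Then `C(A) ⊂ C(A₁) × ⋯ × C(A_s)`, with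
equality holding if and only if `Hom(Aᵢ, Aⱼ) = 0` for all `i, j`, `i ≠ j`."; p. 644 L24–L28 (Prop. 1.5, the same for `S`).  Also
B. Moonen, *An introduction to Mumford–Tate groups* (2004) [Moonen2004MT] §4 Lemma 4.6, C. Voisin [VoisinHodgeI2002] §7.3.1 Lemma 7.26,
H. Lange [Lange2023AbelianVarietiesComplex] §2.4.4 proof of Cor. 2.4.26 (p. 124).

## Dictionary and what is proved (namespace `Literature.AlgebraicGeometry.Motives.HodgeStructure`)

`C(H) = Subalgebra.centralizer ℚ E_φ(H)`, `S(H, ψ)(ℚ) = ψ.lefschetzGroup`, `ψ|_{W_k} = ψ.restrict (W k)`; an internal direct sum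
`W : κ → SubHodgeStructure H` (`DirectSum.IsInternal`); "Hom-orthogonal" = `∀ k ≠ l, Hom_HS(W_k, W_l) = 0`; "`E_φ`-stable" =
`∀ k, ∀ a ∈ E_φ(H), a(W_k) ⊆ W_k`; "every block family lifts" = `∀ (c_k ∈ C(W_k))_k, ∃ c ∈ C(H), c|_{W_k} = c_k`.

* §1 `forall_stable_iff_hom_orthogonal` (`E_φ`-stable ⟺ Hom-orthogonal).
* §2 **`hom_eq_zero_of_forall_exists_centralizer_lift`** («equality ⟹ `Hom(Aᵢ, Aⱼ) = 0`»: if every family `(c_k)_k` lifts to `C(H)`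
  then the blocks are Hom-orthogonal), `forall_exists_centralizer_lift_iff_hom_orthogonal`,
  **`exists_algEquiv_pi_centralizer_iff_hom_orthogonal`** (`C(H) ≃ₐ Π_k C(W_k)` over the restrictions ⟺ Hom-orthogonal),
  **`finrank_centralizer_eq_sum_iff_hom_orthogonal`** (`dim C(H) = Σ_k dim C(W_k)` ⟺ Hom-orthogonal).
* §3 **`Polarization.hom_eq_zero_of_forall_exists_lefschetzGroup_lift`** (with p34's `Polarization.neg_mem_lefschetzGroup`, `-1 ∈ S(ℚ)`),
  `Polarization.forall_exists_lefschetzGroup_lift_iff_hom_orthogonal`, **`Polarization.exists_mulEquiv_pi_lefschetzGroup_iff_hom_orthogonal`**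
  (`S(H)(ℚ) ≃* Π_k S(W_k)(ℚ)` over the restrictions ⟺ Hom-orthogonal).
-/

noncomputable section

namespace Literature.AlgebraicGeometry.Motives

namespace HodgeStructure

universe u

variable {V : Type u} [AddCommGroup V] [Module ℚ V] {n : ℤ} {H : HodgeStructure V n}
  {κ : Type*} [Fintype κ] [DecidableEq κ] (W : κ → SubHodgeStructure H)
  (hW : DirectSum.IsInternal fun k => (W k).toSubmodule)

include hW

/-! ## §1 `E_φ`-stable blocks ⟺ Hom-orthogonal blocks -/

/-- **The blocks of an internal direct sum of sub-Hodge structures are `E_φ`-stable iff they are Hom-orthogonal** (⟹: the Hodge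
endomorphism `ι_l ∘ f ∘ π_k` preserves `W_k`, g52-#3; ⟸: the `(l, k)` entry `π_l ∘ a ∘ ι_k` of `a ∈ E_φ` is a morphism `W_k → W_l`,
the tree's `apply_mem_of_hom_orthogonal`). [cite: Milne1999LefschetzClasses, §1 p. 643 L13–L15]
[cite: Lange2023AbelianVarietiesComplex, §2.4.4 proof of Cor. 2.4.26 (p. 124)] -/
theorem forall_stable_iff_hom_orthogonal :
    (∀ k, ∀ a ∈ H.endAlg, ∀ v ∈ (W k).toSubmodule, a v ∈ (W k).toSubmodule) ↔
      ∀ k l, k ≠ l → ∀ f : Hom (W k).toHodgeStructure (W l).toHodgeStructure, f = 0 := by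
  classical
  exact ⟨fun hst _ _ hkl f => hom_eq_zero_of_forall_stable W hW hst hkl f,
    fun horth k _ ha _ hv => apply_mem_of_hom_orthogonal W hW horth ha k hv⟩

/-! ## §2 «with equality holding if and only if `Hom(Aᵢ, Aⱼ) = 0`» for `C` -/

omit [Fintype κ] in
/-- The Hodge endomorphism `ι_l ∘ f ∘ π_k` of `H` attached to a morphism `f : W_k → W_l`, with its value `f x` on `x ∈ W_k`.
[cite: VoisinHodgeI2002, §7.3.1 Lemma 7.26] -/
theorem exists_mem_endAlg_apply_coe_eq (k l : κ) (f : Hom (W k).toHodgeStructure (W l).toHodgeStructure) :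
    ∃ a ∈ H.endAlg, ∀ x : (W k).toSubmodule, a (x : V) = ((f.toLinearMap x : (W l).toSubmodule) : V) := by
  let πH : Hom H (W k).toHodgeStructure :=
    (SubHodgeStructure.internalProjHom W hW k).codRestrict (W k) (SubHodgeStructure.internalProjHom_apply_mem W hW k)
  refine ⟨((W l).subtypeHom.comp (f.comp πH)).toLinearMap, Hom.toLinearMap_mem_endAlg _, fun x => ?_⟩
  have hπx : πH.toLinearMap (x : V) = x := Subtype.ext (by
    change (SubHodgeStructure.internalProjHom W hW k).toLinearMap (x : V) = x
    rw [SubHodgeStructure.internalProjHom_toLinearMap]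
    exact isInternalProj_apply_of_mem hW x.2)
  rw [Hom.comp_toLinearMap, Hom.comp_toLinearMap, LinearMap.comp_apply, LinearMap.comp_apply, hπx]
  rfl

omit [Fintype κ] in
/-- **«equality holding ⟹ `Hom(Aᵢ, Aⱼ) = 0` for `i ≠ j`»**: if EVERY family `(c_k ∈ C(W_k))_k` is the family of restrictions
of some `c ∈ C(H)`, then the blocks are Hom-orthogonal — lift `(1_{W_k}, 0, …, 0)` to `c`; `c` commutes with the Hodge endomorphism
`a = ι_l ∘ f ∘ π_k`, and `c (a x) = 0`, `a (c x) = f x` for `x ∈ W_k`. [cite: Milne1999LefschetzClasses, §1 p. 643 L13–L15] -/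
theorem hom_eq_zero_of_forall_exists_centralizer_lift
    (hlift : ∀ c : Π k, Subalgebra.centralizer ℚ ((W k).toHodgeStructure.endAlg : Set (Module.End ℚ (W k).toSubmodule)),
      ∃ C ∈ Subalgebra.centralizer ℚ (H.endAlg : Set (Module.End ℚ V)), ∀ (k : κ) (v : (W k).toSubmodule),
        C (v : V) = ((c k : Module.End ℚ (W k).toSubmodule) v : V))
    {k l : κ} (hkl : k ≠ l) (f : Hom (W k).toHodgeStructure (W l).toHodgeStructure) : f = 0 := by
  obtain ⟨C, hC, hCv⟩ := hlift (Pi.single k 1)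
  obtain ⟨a, ha, hax⟩ := exists_mem_endAlg_apply_coe_eq W hW k l f
  have hcomm := (Subalgebra.mem_centralizer_iff ℚ).1 hC a ha
  refine Hom.ext (LinearMap.ext fun x => Subtype.ext ?_)
  -- `a (C x) = a x = f x` and `C (a x) = C (f x) = 0`
  have h1 : C (x : V) = x := by rw [hCv k x, Pi.single_eq_same]; rfl
  have h2 : C ((f.toLinearMap x : (W l).toSubmodule) : V) = 0 := by
    rw [hCv l (f.toLinearMap x), Pi.single_eq_of_ne' hkl]; rfl
  have h := LinearMap.congr_fun hcomm (x : V)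
  rw [Module.End.mul_apply, Module.End.mul_apply, h1, hax x, h2] at h
  rw [h, Hom.zero_toLinearMap, LinearMap.zero_apply, Submodule.coe_zero]

/-- **«`C(A) = C(A₁) × ⋯ × C(A_s)` if and only if `Hom(Aᵢ, Aⱼ) = 0` for all `i ≠ j`», lifting form**: every block family
`(c_k ∈ C(W_k))_k` lifts to `C(H)` iff the blocks are Hom-orthogonal (⟸ by the gluing `Σ_k ι_k c_k π_k ∈ C(H)` of g52-#3).
[cite: Milne1999LefschetzClasses, §1 p. 643 L13–L15] [cite: Moonen2004MT, §4 Lemma 4.6] -/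
theorem forall_exists_centralizer_lift_iff_hom_orthogonal :
    (∀ c : Π k, Subalgebra.centralizer ℚ ((W k).toHodgeStructure.endAlg : Set (Module.End ℚ (W k).toSubmodule)),
      ∃ C ∈ Subalgebra.centralizer ℚ (H.endAlg : Set (Module.End ℚ V)), ∀ (k : κ) (v : (W k).toSubmodule),
        C (v : V) = ((c k : Module.End ℚ (W k).toSubmodule) v : V)) ↔
      ∀ k l, k ≠ l → ∀ f : Hom (W k).toHodgeStructure (W l).toHodgeStructure, f = 0 := by
  refine ⟨fun hlift _ _ hkl f => hom_eq_zero_of_forall_exists_centralizer_lift W hW hlift hkl f, fun horth c => ?_⟩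
  exact ⟨_, sum_comp_mem_centralizer_endAlg_of_hom_orthogonal W hW horth c, fun k v =>
    sum_subtype_comp_comp_codRestrict_apply_of_mem W hW (fun l => (c l : Module.End ℚ (W l).toSubmodule)) v.2⟩

/-- **«with equality holding if and only if `Hom(Aᵢ, Aⱼ) = 0`», isomorphism form**: there is an isomorphism of `ℚ`-algebras
`C(H) ≃ₐ[ℚ] Π_k C(W_k)` lying over the restrictions, `(e c)_k v = c v`, iff the blocks are Hom-orthogonal.
[cite: Milne1999LefschetzClasses, §1 p. 643 L13–L15 and Prop. 1.1] -/
theorem exists_algEquiv_pi_centralizer_iff_hom_orthogonal :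
    (∃ e : Subalgebra.centralizer ℚ (H.endAlg : Set (Module.End ℚ V)) ≃ₐ[ℚ]
        Π k, Subalgebra.centralizer ℚ ((W k).toHodgeStructure.endAlg : Set (Module.End ℚ (W k).toSubmodule)),
      ∀ (c : Subalgebra.centralizer ℚ (H.endAlg : Set (Module.End ℚ V))) (k : κ) (v : (W k).toSubmodule),
        ((e c k : Module.End ℚ (W k).toSubmodule) v : V) = (c : Module.End ℚ V) v) ↔
      ∀ k l, k ≠ l → ∀ f : Hom (W k).toHodgeStructure (W l).toHodgeStructure, f = 0 := by
  refine ⟨fun ⟨e, he⟩ => (forall_exists_centralizer_lift_iff_hom_orthogonal W hW).1 fun c => ?_,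
    fun horth => exists_algEquiv_pi_centralizer_of_hom_orthogonal W hW horth⟩
  refine ⟨(e.symm c : Module.End ℚ V), (e.symm c).2, fun k v => ?_⟩
  rw [← he (e.symm c) k v, AlgEquiv.apply_symm_apply]

/-- **«with equality holding if and only if `Hom(Aᵢ, Aⱼ) = 0`», dimension form**: `dim_ℚ C(H) = Σ_k dim_ℚ C(W_k)` iff the blocks
are Hom-orthogonal (restriction `C(H) ↪ Π_k C(W_k)` is always injective, g52-#3; it is onto iff the dimensions agree).
[cite: Milne1999LefschetzClasses, §1 p. 643 L13–L15 and Prop. 1.1] -/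
theorem finrank_centralizer_eq_sum_iff_hom_orthogonal [Module.Finite ℚ V] :
    Module.finrank ℚ (Subalgebra.centralizer ℚ (H.endAlg : Set (Module.End ℚ V))) =
        ∑ k, Module.finrank ℚ
          (Subalgebra.centralizer ℚ ((W k).toHodgeStructure.endAlg : Set (Module.End ℚ (W k).toSubmodule))) ↔
      ∀ k l, k ≠ l → ∀ f : Hom (W k).toHodgeStructure (W l).toHodgeStructure, f = 0 := by
  refine ⟨fun hdim => ?_, fun horth => finrank_centralizer_eq_sum_of_hom_orthogonal W hW horth⟩
  obtain ⟨r, hr, hinj⟩ := exists_algHom_pi_centralizer W hW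
  haveI : ∀ k, Module.Free ℚ
      (Subalgebra.centralizer ℚ ((W k).toHodgeStructure.endAlg : Set (Module.End ℚ (W k).toSubmodule))) := fun k => by
    exact Module.Free.of_divisionRing ℚ
      (Subalgebra.centralizer ℚ ((W k).toHodgeStructure.endAlg : Set (Module.End ℚ (W k).toSubmodule)))
  -- `ρ : C(H) → Π_k End(W_k)`, `c ↦ (c|_{W_k})_k`, and `j : Π_k C(W_k) → Π_k End(W_k)` (inclusions), read in the ambient
  -- `Π_k End(W_k)`; both injective, `range ρ ≤ range j`, and the ranges have the same dimension
  let ρ : Subalgebra.centralizer ℚ (H.endAlg : Set (Module.End ℚ V)) →ₗ[ℚ] Π k, Module.End ℚ (W k).toSubmodule :=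
    { toFun := fun c k => (r c k : Module.End ℚ (W k).toSubmodule)
      map_add' := fun x y => by funext k; rw [map_add]; rfl
      map_smul' := fun q x => by funext k; rw [map_smul]; rfl }
  let j : (Π k, Subalgebra.centralizer ℚ ((W k).toHodgeStructure.endAlg : Set (Module.End ℚ (W k).toSubmodule))) →ₗ[ℚ]
      Π k, Module.End ℚ (W k).toSubmodule :=
    { toFun := fun c k => (c k : Module.End ℚ (W k).toSubmodule)
      map_add' := fun x y => rfl
      map_smul' := fun q x => rfl }
  have hρ : Function.Injective ρ := fun a b h => hinj (funext fun k => Subtype.ext (congr_fun h k))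
  have hj : Function.Injective j := fun a b h => funext fun k => Subtype.ext (congr_fun h k)
  have hle : LinearMap.range ρ ≤ LinearMap.range j := by
    rintro _ ⟨c, rfl⟩
    exact ⟨r c, rfl⟩
  have hfin : Module.finrank ℚ (LinearMap.range ρ) = Module.finrank ℚ (LinearMap.range j) := by
    rw [LinearMap.finrank_range_of_inj hρ, LinearMap.finrank_range_of_inj hj, hdim, Module.finrank_pi_fintype]
  have heq : LinearMap.range ρ = LinearMap.range j := Submodule.eq_of_le_of_finrank_eq hle hfin
  refine (forall_exists_centralizer_lift_iff_hom_orthogonal W hW).1 fun c => ?_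
  have hc : j c ∈ LinearMap.range ρ := heq ▸ ⟨c, rfl⟩
  obtain ⟨C, hC⟩ := hc
  refine ⟨C, C.2, fun k v => ?_⟩
  have hk : (r C k : Module.End ℚ (W k).toSubmodule) = (c k : Module.End ℚ (W k).toSubmodule) := congr_fun hC k
  rw [← hr C k v, hk]

/-! ## §3 The same for `S(H)(ℚ)`: every family of `S(W_k, ψ|_{W_k})(ℚ)` lifts iff the blocks are Hom-orthogonal -/

omit [Fintype κ] in
/-- **«equality ⟹ `Hom(Aᵢ, Aⱼ) = 0`» for `S`**: if EVERY family `(γ_k ∈ S(W_k, ψ|_{W_k})(ℚ))_k` is the family of restrictions of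
some `g ∈ S(H, ψ)(ℚ)`, then the blocks are Hom-orthogonal — lift the block-sign family `(-1_{W_k}, 1, …, 1)` to `g`; `g` commutes
with `a = ι_l ∘ f ∘ π_k ∈ E_φ`, so `f x = g (a x) = a (g x) = -f x` for `x ∈ W_k`. [cite: Milne1999LefschetzClasses, §1 p. 643 L13–L15 and Prop. 1.5 (p. 644)] -/
theorem Polarization.hom_eq_zero_of_forall_exists_lefschetzGroup_lift (ψ : Polarization H)
    (hlift : ∀ γ : Π k, (ψ.restrict (W k)).lefschetzGroup, ∃ g ∈ ψ.lefschetzGroup, ∀ (k : κ) (v : (W k).toSubmodule),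
      g (v : V) = ((γ k : (W k).toSubmodule ≃ₗ[ℚ] (W k).toSubmodule) v : V))
    {k l : κ} (hkl : k ≠ l) (f : Hom (W k).toHodgeStructure (W l).toHodgeStructure) : f = 0 := by
  obtain ⟨g, hg, hgv⟩ := hlift (Pi.mulSingle k ⟨LinearEquiv.neg ℚ, (ψ.restrict (W k)).neg_mem_lefschetzGroup⟩)
  obtain ⟨a, ha, hax⟩ := exists_mem_endAlg_apply_coe_eq W hW k l f
  refine Hom.ext (LinearMap.ext fun x => Subtype.ext ?_)
  -- `g x = -x`, `g (f x) = f x`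
  have h1 : g (x : V) = -(x : V) := by
    rw [hgv k x, Pi.mulSingle_eq_same]
    rfl
  have h2 : g ((f.toLinearMap x : (W l).toSubmodule) : V) = ((f.toLinearMap x : (W l).toSubmodule) : V) := by
    rw [hgv l (f.toLinearMap x), Pi.mulSingle_eq_of_ne' hkl]
    rfl
  have h := hg.1 ⟨a, ha⟩ (x : V)
  change a (g (x : V)) = g (a (x : V)) at h
  rw [h1, map_neg, hax x, h2] at h
  -- `-y = y` forces `y = 0` in a `ℚ`-vector space
  have h2y : (2 : ℚ) • ((f.toLinearMap x : (W l).toSubmodule) : V) = 0 := by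
    rw [two_smul]
    nth_rw 1 [← h]
    exact neg_add_cancel _
  rw [Hom.zero_toLinearMap, LinearMap.zero_apply, Submodule.coe_zero]
  exact (smul_eq_zero.1 h2y).resolve_left two_ne_zero

/-- **«`S(A) = S(A₁) × ⋯ × S(A_s)` if and only if `Hom(Aᵢ, Aⱼ) = 0`», lifting form**: every family `(γ_k ∈ S(W_k, ψ|_{W_k})(ℚ))_k`
lifts to `S(H, ψ)(ℚ)` iff the blocks are Hom-orthogonal (⟸ is the gluing of g52-#4).
[cite: Milne1999LefschetzClasses, §1 p. 643 L13–L15 and Prop. 1.5 (p. 644)] -/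
theorem Polarization.forall_exists_lefschetzGroup_lift_iff_hom_orthogonal [Module.Finite ℚ V] (ψ : Polarization H) :
    (∀ γ : Π k, (ψ.restrict (W k)).lefschetzGroup, ∃ g ∈ ψ.lefschetzGroup, ∀ (k : κ) (v : (W k).toSubmodule),
      g (v : V) = ((γ k : (W k).toSubmodule ≃ₗ[ℚ] (W k).toSubmodule) v : V)) ↔
      ∀ k l, k ≠ l → ∀ f : Hom (W k).toHodgeStructure (W l).toHodgeStructure, f = 0 :=
  ⟨fun hlift _ _ hkl f => ψ.hom_eq_zero_of_forall_exists_lefschetzGroup_lift W hW hlift hkl f,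
    fun horth γ => ψ.exists_mem_lefschetzGroup_forall_apply_eq_of_hom_orthogonal W hW horth γ⟩

/-- **«with equality holding if and only if `Hom(Aᵢ, Aⱼ) = 0`» for `S`, isomorphism form**: there is an isomorphism
`S(H, ψ)(ℚ) ≃* Π_k S(W_k, ψ|_{W_k})(ℚ)` lying over the restrictions, `(e g)_k v = g v`, iff the blocks are Hom-orthogonal.
[cite: Milne1999LefschetzClasses, §1 Prop. 1.5 (p. 644) and p. 643 L13–L15] -/
theorem Polarization.exists_mulEquiv_pi_lefschetzGroup_iff_hom_orthogonal [Module.Finite ℚ V] (ψ : Polarization H) :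
    (∃ e : ψ.lefschetzGroup ≃* Π k, (ψ.restrict (W k)).lefschetzGroup,
      ∀ (g : ψ.lefschetzGroup) (k : κ) (v : (W k).toSubmodule),
        ((e g k : (W k).toSubmodule ≃ₗ[ℚ] (W k).toSubmodule) v : V) = (g : V ≃ₗ[ℚ] V) v) ↔
      ∀ k l, k ≠ l → ∀ f : Hom (W k).toHodgeStructure (W l).toHodgeStructure, f = 0 := by
  refine ⟨fun ⟨e, he⟩ => (ψ.forall_exists_lefschetzGroup_lift_iff_hom_orthogonal W hW).1 fun γ => ?_,
    fun horth => ψ.exists_mulEquiv_pi_lefschetzGroup_of_hom_orthogonal W hW horth⟩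
  refine ⟨((e.symm γ : ψ.lefschetzGroup) : V ≃ₗ[ℚ] V), (e.symm γ).2, fun k v => ?_⟩
  rw [← he (e.symm γ) k v, MulEquiv.apply_symm_apply]

end HodgeStructure

end Literature.AlgebraicGeometry.Motives
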